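import Mathlib
import Summits.KontsevichZagierPeriods.KontsevichZagierPeriods.Theorems.SoloInformedZetaFourStep
import HarnessLib
import HarnessLib.Audit

/-!
# Informed soloist — THM XXXVIII: the ORDER-CELL ENGINE (rule (1a) dissection into order cells)

For a permutation `σ` of `Fin n` the *order cell* is
`C_σ = {x : ℝⁿ | x (σ 0) < x (σ 1) < ⋯ < x (σ (n-1))}` (`soloInformedCell σ`).
The `n!` order cells are pairwise disjoint `ℚ`-semialgebraic sets which cover `ℝⁿ` off the
Lebesgue-null diagonal hyperplanes `{xᵢ = xⱼ}`. Hence for ANY integral representation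
`r = [D, f]` of the Kontsevich–Zagier calculus

  `[r] − ∑_σ [r|_{D ∩ C_σ}] ∈ KZ.relations`                    (`soloInformed_of_sub_sum_cells`),

by iterated rule (1a) (`KZ.of_sub_sum_of_mem_relations_of_subset`). Three refinements make this
the engine behind the "garland" dissections of PART XVI (done there by hand for `n = 4`):

* empty pieces may be dropped (`soloInformed_of_sub_sum_cells_of_subset`);
* if `D` lies in an *order polytope* `P_E = {x | x a < x b, (a, b) ∈ E}` then only the cells of the
  LINEAR EXTENSIONS of `E` meet `D`; compatibility `σ ⊨ E` is DECIDABLE, so the index set of the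
  dissection is certified by `decide` (`soloInformed_of_sub_sum_linext`; kernel smoke test
  `soloInformed_linext_card_vee`);
* every cell piece is carried onto a piece over Kontsevich's simplex
  `KZ.openOrderedSimplex n = {1 > t₀ > t₁ > ⋯ > t_{n-1} > 0}` by the coordinate permutation
  `rev ∘ σ⁻¹` (rule (2), `KZ.of_sub_of_reindex_mem_relations`): `soloInformed_reindex_cubeCell_domain`,
  and the packaged **cube = n! simplices** relation `soloInformed_of_sub_sum_simplexPieces`.

Products of MZV simplices are order polytopes of forests, and their dissection into the simplices
of the linear extensions (the domain side of the shuffle AND of the telescoping garlands) is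
exactly `soloInformed_of_sub_sum_linext` followed by `soloInformed_reindex_cubeCell_domain`.
[Kontsevich–Zagier 2001, §1.2 rules (1a), (2)]
-/

open MeasureTheory Set MvPolynomial
open Literature.ModelTheory.ExponentialFields Literature.NumberTheory.Transcendental
open Literature.NumberTheory.Transcendental.KZ

namespace Summit.KontsevichZagierPeriods.KontsevichZagierPeriods.Theorems

variable {n : ℕ}

/-! ### Order cells -/

/-- The order cell of `σ`: the tuples increasing strictly along `σ`, `x (σ 0) < x (σ 1) < ⋯`. -/
def soloInformedCell (σ : Equiv.Perm (Fin n)) : Set (Fin n → ℝ) := {x | StrictMono (x ∘ ⇑σ)}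

/-- Membership in an order cell. -/
theorem soloInformed_mem_cell_iff {σ : Equiv.Perm (Fin n)} {x : Fin n → ℝ} :
    x ∈ soloInformedCell σ ↔ StrictMono (x ∘ ⇑σ) := Iff.rfl

/-- An order cell is a finite intersection of coordinate half-spaces `{x (σ a) < x (σ b)}`, `a < b`. -/
theorem soloInformed_cell_eq_biInter (σ : Equiv.Perm (Fin n)) :
    soloInformedCell σ = ⋂ p ∈ (Finset.univ.filter fun p : Fin n × Fin n => p.1 < p.2),
      {x : Fin n → ℝ | x (σ p.1) < x (σ p.2)} := by
  ext x
  simp only [soloInformed_mem_cell_iff, StrictMono, Function.comp_apply, mem_iInter,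
    Finset.mem_filter, Finset.mem_univ, true_and, mem_setOf_eq, Prod.forall]

/-- Order cells are `ℚ`-semialgebraic. [BCR 1998, §2.1] -/
theorem soloInformed_isSemialgebraic_cell (σ : Equiv.Perm (Fin n)) :
    IsSemialgebraic ℚ (soloInformedCell σ) := by
  rw [soloInformed_cell_eq_biInter]
  refine IsSemialgebraic.biInter _ _ fun p _ => ?_
  simpa using isSemialgebraic_setOf_eval_lt (k := ℚ) (R := ℝ)
    (X (σ p.1) : MvPolynomial (Fin n) ℚ) (X (σ p.2))

/-- Order cells are Lebesgue-measurable. -/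
theorem soloInformed_measurableSet_cell (σ : Equiv.Perm (Fin n)) :
    MeasurableSet (soloInformedCell σ) :=
  IsSemialgebraic.measurableSet_holds (soloInformed_isSemialgebraic_cell σ)

/-- A tuple lying in an order cell is injective (pairwise distinct coordinates). -/
theorem soloInformed_injective_of_mem_cell {σ : Equiv.Perm (Fin n)} {x : Fin n → ℝ}
    (hx : x ∈ soloInformedCell σ) : Function.Injective x := fun a b hab =>
  σ.symm.injective (hx.injective (by simpa using hab))

/-- Distinct permutations have disjoint order cells: the increasing rearrangement of an injective
tuple is unique (`Tuple.unique_monotone`). -/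
theorem soloInformed_cell_disjoint {σ τ : Equiv.Perm (Fin n)} (h : σ ≠ τ) :
    Disjoint (soloInformedCell σ) (soloInformedCell τ) :=
  disjoint_left.2 fun _ hσ hτ => h <| Equiv.ext fun i =>
    soloInformed_injective_of_mem_cell hσ
      (congrFun (Tuple.unique_monotone hσ.monotone hτ.monotone) i)

/-- Every injective tuple lies in an order cell, namely the one of `Tuple.sort`. -/
theorem soloInformed_exists_mem_cell {x : Fin n → ℝ} (hx : Function.Injective x) :
    ∃ σ : Equiv.Perm (Fin n), x ∈ soloInformedCell σ :=
  ⟨Tuple.sort x,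
    (Tuple.monotone_sort x).strictMono_of_injective (hx.comp (Tuple.sort x).injective)⟩

/-- The order cells cover any set `D` up to a Lebesgue-null set (a subset of the finite union of the
diagonal hyperplanes `{xᵢ = xⱼ}`, `KZ.volume_setOf_apply_eq_apply`). -/
theorem soloInformed_volume_diff_iUnion_cells (D : Set (Fin n → ℝ)) :
    volume (D \ ⋃ σ : Equiv.Perm (Fin n), D ∩ soloInformedCell σ) = 0 := by
  have hsub : D \ (⋃ σ : Equiv.Perm (Fin n), D ∩ soloInformedCell σ) ⊆
      ⋃ p : Fin n × Fin n, {x : Fin n → ℝ | p.1 ≠ p.2 ∧ x p.1 = x p.2} := by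
    intro x hx
    have hninj : ¬ Function.Injective x := fun hinj => hx.2 <| by
      obtain ⟨σ, hσ⟩ := soloInformed_exists_mem_cell hinj
      exact mem_iUnion.2 ⟨σ, hx.1, hσ⟩
    obtain ⟨i, j, hij, hne⟩ := Function.not_injective_iff.1 hninj
    exact mem_iUnion.2 ⟨(i, j), hne, hij⟩
  refine measure_mono_null hsub (measure_iUnion_null fun p => ?_)
  by_cases hp : p.1 = p.2
  · rw [show {x : Fin n → ℝ | p.1 ≠ p.2 ∧ x p.1 = x p.2} = ∅ from
      eq_empty_of_forall_notMem fun x hx => hx.1 hp, measure_empty]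
  · rw [show {x : Fin n → ℝ | p.1 ≠ p.2 ∧ x p.1 = x p.2} = {x | x p.1 = x p.2} by ext x; simp [hp]]
    exact volume_setOf_apply_eq_apply hp

/-! ### The dissection (rule (1a)) -/

/-- The piece of `r` over the order cell of `σ`: same integrand, domain `r.domain ∩ C_σ`. -/
def soloInformedCellRep (r : IntegralRep n) (σ : Equiv.Perm (Fin n)) : IntegralRep n :=
  r.restrict (r.domain ∩ soloInformedCell σ)
    (r.isSemialgebraic_domain.inter (soloInformed_isSemialgebraic_cell σ)) inter_subset_left

/-- The domain of a cell piece. -/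
@[simp] theorem soloInformedCellRep_domain (r : IntegralRep n) (σ : Equiv.Perm (Fin n)) :
    (soloInformedCellRep r σ).domain = r.domain ∩ soloInformedCell σ := rfl

/-- The integrand of a cell piece. -/
@[simp] theorem soloInformedCellRep_integrand (r : IntegralRep n) (σ : Equiv.Perm (Fin n)) :
    (soloInformedCellRep r σ).integrand = r.integrand := rfl

/-- **THM XXXVIII (order-cell dissection).** For every integral representation `r` in `n` variables,
`[r] − ∑_{σ ∈ 𝔖ₙ} [r|_{C_σ}] ∈ KZ.relations` — iterated rule (1a) over the `n!` order cells, the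
uncovered part of the domain being Lebesgue-null. [Kontsevich–Zagier 2001, §1.2 rule (1a)] -/
theorem soloInformed_of_sub_sum_cells (r : IntegralRep n) :
    of r - ∑ σ : Equiv.Perm (Fin n), of (soloInformedCellRep r σ) ∈ relations := by
  have hcov : volume (r.domain \ ⋃ σ ∈ (Finset.univ : Finset (Equiv.Perm (Fin n))),
      (soloInformedCellRep r σ).domain) = 0 := by
    simpa only [soloInformedCellRep_domain, Finset.mem_univ, iUnion_true] using
      soloInformed_volume_diff_iUnion_cells r.domain
  exact of_sub_sum_of_mem_relations_of_subset Finset.univ r (soloInformedCellRep r)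
    (fun σ _ => inter_subset_left) (fun σ _ => fun x _ => rfl) hcov
    (fun σ _ τ _ hστ => (soloInformed_cell_disjoint hστ).mono inter_subset_right inter_subset_right)

/-- **Dropping empty pieces.** If the cells outside `S` do not meet the domain, the dissection may
be summed over `S` only (the dropped pieces have empty, hence null, domain). -/
theorem soloInformed_of_sub_sum_cells_of_subset (r : IntegralRep n)
    (S : Finset (Equiv.Perm (Fin n))) (hS : ∀ σ ∉ S, r.domain ∩ soloInformedCell σ = ∅) :
    of r - ∑ σ ∈ S, of (soloInformedCellRep r σ) ∈ relations := by
  classical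
  have h0 : ∀ σ ∉ S, of (soloInformedCellRep r σ) ∈ relations := fun σ hσ =>
    of_mem_relations_of_volume_eq_zero _ (by rw [soloInformedCellRep_domain, hS σ hσ, measure_empty])
  have hsum : ∑ σ ∈ Sᶜ, of (soloInformedCellRep r σ) ∈ relations :=
    sum_mem fun σ hσ => h0 σ (Finset.mem_compl.1 hσ)
  have heq : of r - ∑ σ ∈ S, of (soloInformedCellRep r σ) =
      (of r - ∑ σ, of (soloInformedCellRep r σ)) +
        ∑ σ ∈ Sᶜ, of (soloInformedCellRep r σ) := by
    rw [← Finset.sum_add_sum_compl S]; abel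
  rw [heq]
  exact add_mem (soloInformed_of_sub_sum_cells r) hsum

/-! ### Order polytopes and linear extensions -/

/-- The (open) order polytope of a constraint list `E`: `x a < x b` for every `(a, b) ∈ E`. -/
def soloInformedOrderSet (E : List (Fin n × Fin n)) : Set (Fin n → ℝ) :=
  {x | ∀ p ∈ E, x p.1 < x p.2}

/-- `σ` is a linear extension of `E`: the position `σ⁻¹ a` comes before `σ⁻¹ b` for `(a, b) ∈ E`. -/
def soloInformedCompat (E : List (Fin n × Fin n)) (σ : Equiv.Perm (Fin n)) : Prop :=
  ∀ p ∈ E, σ.symm p.1 < σ.symm p.2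

/-- Compatibility is decidable, so the linear extensions of `E` are enumerated by `decide`. -/
instance soloInformedDecidableCompat (E : List (Fin n × Fin n)) (σ : Equiv.Perm (Fin n)) :
    Decidable (soloInformedCompat E σ) := by
  unfold soloInformedCompat; infer_instance

/-- The cell of a linear extension lies in the order polytope. -/
theorem soloInformed_cell_subset_orderSet {E : List (Fin n × Fin n)} {σ : Equiv.Perm (Fin n)}
    (h : soloInformedCompat E σ) : soloInformedCell σ ⊆ soloInformedOrderSet E :=
  fun x hx p hp => by simpa using hx (h p hp)

/-- The cell of a non-extension misses the order polytope. -/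
theorem soloInformed_orderSet_inter_cell {E : List (Fin n × Fin n)} {σ : Equiv.Perm (Fin n)}
    (h : ¬ soloInformedCompat E σ) : soloInformedOrderSet E ∩ soloInformedCell σ = ∅ := by
  refine eq_empty_of_forall_notMem fun x hx => h fun p hp => ?_
  have hlt : x p.1 < x p.2 := hx.1 p hp
  by_contra hle
  rw [not_lt] at hle
  rcases hle.eq_or_lt with heq | hlt'
  · rw [σ.symm.injective heq] at hlt
    exact lt_irrefl _ hlt
  · have h' : x p.2 < x p.1 := by simpa using hx.2 hlt'
    exact lt_asymm hlt h'

/-- Inside an order polytope the pieces of the linear extensions are plain cell pieces. -/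
theorem soloInformed_inter_orderSet_inter_cell {E : List (Fin n × Fin n)} {σ : Equiv.Perm (Fin n)}
    (h : soloInformedCompat E σ) (U : Set (Fin n → ℝ)) :
    U ∩ soloInformedOrderSet E ∩ soloInformedCell σ = U ∩ soloInformedCell σ := by
  ext x
  exact ⟨fun hx => ⟨hx.1.1, hx.2⟩,
    fun hx => ⟨⟨hx.1, soloInformed_cell_subset_orderSet h hx.2⟩, hx.2⟩⟩

/-- **THM XXXVIII-bis (dissection of an order polytope into the cells of its linear extensions).**
If the domain of `r` lies in the order polytope `P_E` and `S` contains every linear extension of `E`,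
then `[r] − ∑_{σ ∈ S} [r|_{C_σ}] ∈ KZ.relations`. With `S` an explicit list, the side condition
`∀ σ, σ ⊨ E → σ ∈ S` is closed by `decide`. [Kontsevich–Zagier 2001, §1.2 rule (1a); Stanley,
*Two poset polytopes* (1986), §1 (order polytope = union of the simplices of linear extensions)] -/
theorem soloInformed_of_sub_sum_linext (r : IntegralRep n) (E : List (Fin n × Fin n))
    (hr : r.domain ⊆ soloInformedOrderSet E) (S : Finset (Equiv.Perm (Fin n)))
    (hS : ∀ σ, soloInformedCompat E σ → σ ∈ S) :
    of r - ∑ σ ∈ S, of (soloInformedCellRep r σ) ∈ relations :=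
  soloInformed_of_sub_sum_cells_of_subset r S fun σ hσ =>
    subset_eq_empty (inter_subset_inter_left _ hr)
      (soloInformed_orderSet_inter_cell fun hc => hσ (hS σ hc))

/-- Kernel smoke test of the decision procedure: the "vee" poset `x₀ < x₁, x₀ < x₂` on three
coordinates has exactly two linear extensions. -/
theorem soloInformed_linext_card_vee :
    (Finset.univ.filter fun σ : Equiv.Perm (Fin 3) =>
      soloInformedCompat [((0 : Fin 3), 1), (0, 2)] σ).card = 2 := by
  decide

/-! ### Cell pieces are pieces over Kontsevich's simplex (rule (2)) -/

/-- Precomposition with `Fin.rev` turns strictly increasing into strictly decreasing. -/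
theorem soloInformed_strictMono_comp_rev_iff {w : Fin n → ℝ} :
    StrictMono (fun j => w (Fin.rev j)) ↔ StrictAnti w := by
  constructor
  · intro h i j hij
    simpa using h (Fin.rev_lt_rev.2 hij)
  · intro h i j hij
    exact h (Fin.rev_lt_rev.2 hij)

/-- The coordinate permutation `rev ∘ σ⁻¹` carrying the cell of `σ` to the decreasing cell. -/
def soloInformedCellPerm (σ : Equiv.Perm (Fin n)) : Equiv.Perm (Fin n) := σ.symm.trans Fin.revPerm

/-- `soloInformedCellPerm σ` sends `σ i` to `rev i`. -/
@[simp] theorem soloInformedCellPerm_apply_perm (σ : Equiv.Perm (Fin n)) (i : Fin n) :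
    soloInformedCellPerm σ (σ i) = Fin.rev i := by
  simp [soloInformedCellPerm]

/-- **Reindexed cube cells are Kontsevich simplices.** If `r` lives on the cube cell
`(0,1)ⁿ ∩ C_σ`, then `r.reindex (soloInformedCellPerm σ)` lives on `KZ.openOrderedSimplex n`. -/
theorem soloInformed_reindex_cubeCell_domain (r : IntegralRep n) (σ : Equiv.Perm (Fin n))
    (h : r.domain = soloInformedOpenCube n ∩ soloInformedCell σ) :
    (r.reindex (soloInformedCellPerm σ)).domain = openOrderedSimplex n := by
  ext w
  have hcomp : ((fun i => w (soloInformedCellPerm σ i)) ∘ ⇑σ) = fun j => w (Fin.rev j) := by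
    ext j; simp
  simp only [IntegralRep.reindex_domain, h, mem_setOf_eq, mem_inter_iff,
    soloInformed_mem_openCube_iff, soloInformed_mem_cell_iff, openOrderedSimplex, hcomp,
    soloInformed_strictMono_comp_rev_iff]
  constructor
  · rintro ⟨hc, hm⟩
    refine ⟨fun i => ?_, fun i => ?_, hm⟩
    · simpa using (hc ((soloInformedCellPerm σ).symm i)).1
    · simpa using (hc ((soloInformedCellPerm σ).symm i)).2
  · rintro ⟨h0, h1, hm⟩
    exact ⟨fun j => ⟨h0 _, h1 _⟩, hm⟩

/-- The simplex piece of `r` attached to `σ`: the cell piece reindexed along `soloInformedCellPerm σ`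
(integrand `w ↦ f (w ∘ rev ∘ σ⁻¹)`). -/
def soloInformedSimplexPiece (r : IntegralRep n) (σ : Equiv.Perm (Fin n)) : IntegralRep n :=
  (soloInformedCellRep r σ).reindex (soloInformedCellPerm σ)

/-- Over the open cube, every simplex piece lives on `KZ.openOrderedSimplex n`. -/
theorem soloInformedSimplexPiece_domain (r : IntegralRep n) (hr : r.domain = soloInformedOpenCube n)
    (σ : Equiv.Perm (Fin n)) : (soloInformedSimplexPiece r σ).domain = openOrderedSimplex n :=
  soloInformed_reindex_cubeCell_domain _ σ (by rw [soloInformedCellRep_domain, hr])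

/-- The integrand of a simplex piece. -/
@[simp] theorem soloInformedSimplexPiece_integrand (r : IntegralRep n) (σ : Equiv.Perm (Fin n)) :
    (soloInformedSimplexPiece r σ).integrand =
      fun w => r.integrand fun i => w (soloInformedCellPerm σ i) := rfl

/-- **THM XXXVIII-ter (a representation is the sum of its `n!` simplex pieces).**
`[r] − ∑_σ [simplex piece_σ] ∈ KZ.relations`: order-cell dissection (rule (1a)) followed by the
coordinate permutations `rev ∘ σ⁻¹` (rule (2)). Over the cube `(0,1)ⁿ` every piece lives on
Kontsevich's simplex (`soloInformedSimplexPiece_domain`), i.e. is an iterated integral of MZV shape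
as soon as the integrand is a product of the forms `ω₀, ω₁`.
[Kontsevich–Zagier 2001, §1.2 rules (1a), (2)] -/
theorem soloInformed_of_sub_sum_simplexPieces (r : IntegralRep n) :
    of r - ∑ σ : Equiv.Perm (Fin n), of (soloInformedSimplexPiece r σ) ∈ relations := by
  have h2 : ∑ σ : Equiv.Perm (Fin n), (of (soloInformedCellRep r σ) -
      of (soloInformedSimplexPiece r σ)) ∈ relations :=
    sum_mem fun σ _ => of_sub_of_reindex_mem_relations _ _
  have heq : of r - ∑ σ : Equiv.Perm (Fin n), of (soloInformedSimplexPiece r σ) =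
      (of r - ∑ σ, of (soloInformedCellRep r σ)) +
        ∑ σ : Equiv.Perm (Fin n), (of (soloInformedCellRep r σ) - of (soloInformedSimplexPiece r σ)) := by
    rw [Finset.sum_sub_distrib]; abel
  rw [heq]
  exact add_mem (soloInformed_of_sub_sum_cells r) h2

end Summit.KontsevichZagierPeriods.KontsevichZagierPeriods.Theorems
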